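import Mathlib
import Summits.Ventures.PercRepro2.Defs
import Summits.Ventures.PercRepro2.Independence
import Summits.Ventures.PercRepro2.Graph
import Summits.Ventures.PercRepro2.Events
import Summits.Ventures.PercRepro2.MM0Sector
import Summits.Ventures.PercRepro2.MM0SeriesMap

/-!
# Row 2′MM0, the series rule II: suppressing an unmarked vertex of degree two leaves (MM0⁻) unchanged
(blind cell PercRepro2, night-1 g4; `proofs/NIGHT1-G4.md` §3)

With the series map and the reduced graph of `MM0SeriesMap`: every mass of `mm0minusForm` is the
probability of a Boolean combination of connection events between the six marks, each such event is
the `seriesMap`-preimage of the corresponding event of the reduced graph (`connEvent_series`,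
`gate_series`, `Zev_series`), and the reduced events do not depend on the loop edge `e₂`
(`edgeIndep_*`); `prob_series` then gives `P_p(A) = P_{p′}(A′)` and

* **`mm0minusForm_series`**: `mm0minusForm p ends s t b u w v =
  mm0minusForm p[e₁ ↦ p e₁ · p e₂] (seriesEnds ends e₁ e₂ a c x) s t b u w v` whenever none of the
  six marks is `x`.

Together with `MM0Prune` (the leaf rule) this is the weighted reduction of every forest to its marked
skeleton; the per-skeleton certificates (exact, kit j215069) close «(MM0⁻) on every forest» on paper.
-/

namespace Summit.Ventures.PercRepro2
namespace MM0Series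

open MM0Sector

/-! ## Events that do not depend on one edge -/

section EdgeIndep

variable {V : Type*} {E : Type*} [DecidableEq E]

/-- «`A` does not depend on the state of the edge `e`» is closed under intersection. -/
lemma edgeIndep_inter {e : E} {A B : Set (Config E)}
    (hA : ∀ ω b, Function.update ω e b ∈ A ↔ ω ∈ A)
    (hB : ∀ ω b, Function.update ω e b ∈ B ↔ ω ∈ B) :
    ∀ ω b, Function.update ω e b ∈ A ∩ B ↔ ω ∈ A ∩ B := fun ω b => by
  simp only [Set.mem_inter_iff, hA ω b, hB ω b]

/-- … and under union. -/
lemma edgeIndep_union {e : E} {A B : Set (Config E)}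
    (hA : ∀ ω b, Function.update ω e b ∈ A ↔ ω ∈ A)
    (hB : ∀ ω b, Function.update ω e b ∈ B ↔ ω ∈ B) :
    ∀ ω b, Function.update ω e b ∈ A ∪ B ↔ ω ∈ A ∪ B := fun ω b => by
  simp only [Set.mem_union, hA ω b, hB ω b]

/-- … and under complement. -/
lemma edgeIndep_compl {e : E} {A : Set (Config E)}
    (hA : ∀ ω b, Function.update ω e b ∈ A ↔ ω ∈ A) :
    ∀ ω b, Function.update ω e b ∈ Aᶜ ↔ ω ∈ Aᶜ := fun ω b => by
  simp only [Set.mem_compl_iff, hA ω b]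

/-- A connection event does not depend on a loop edge. -/
lemma edgeIndep_connEvent_loop {ends' : E → Sym2 V} {e : E} {y : V} (hl : ends' e = s(y, y))
    (m₁ m₂ : V) : ∀ ω b, Function.update ω e b ∈ connEvent ends' m₁ m₂ ↔ ω ∈ connEvent ends' m₁ m₂ :=
  fun ω b => by
  simp only [connEvent, Set.mem_setOf_eq]
  exact conn_update_loop_iff' hl ω b

end EdgeIndep

/-! ## The series rule for the (MM0⁻) form -/

section Masses

open MM0Sector

variable {V : Type*} {E : Type*} [Fintype E] [DecidableEq E] [Fintype V] [DecidableEq V]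
  {R : Type*} [CommRing R] [LinearOrder R] [IsStrictOrderedRing R]
  {ends : E → Sym2 V} {e₁ e₂ : E} {a c x : V}

omit [Fintype V] [DecidableEq V] [LinearOrder R] [IsStrictOrderedRing R] in
/-- `P_p(seriesMap⁻¹ A′) = P_{p′}(A′)` for an event `A′` that does not depend on `e₂`. -/
lemma prob_series (p : E → R) (h12 : e₁ ≠ e₂) (A' : Set (Config E))
    (hA' : ∀ ω b, Function.update ω e₂ b ∈ A' ↔ ω ∈ A') :
    prob p (seriesMap e₁ e₂ ⁻¹' A') = prob (Function.update p e₁ (p e₁ * p e₂)) A' := by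
  rw [prob_eq_expect_indicator, prob_eq_expect_indicator]
  have hind : (seriesMap e₁ e₂ ⁻¹' A').indicator (1 : Config E → R) =
      fun ω => A'.indicator 1 (seriesMap e₁ e₂ ω) := by
    funext ω
    by_cases h : seriesMap e₁ e₂ ω ∈ A'
    · rw [Set.indicator_of_mem (Set.mem_preimage.2 h), Set.indicator_of_mem h]
      rfl
    · rw [Set.indicator_of_notMem (fun h' => h (Set.mem_preimage.1 h')), Set.indicator_of_notMem h]
  rw [hind]
  refine expect_seriesMap p _ h12 (fun ω b => ?_)
  by_cases h : ω ∈ A'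
  · rw [Set.indicator_of_mem h, Set.indicator_of_mem ((hA' ω b).2 h)]
    rfl
  · rw [Set.indicator_of_notMem h, Set.indicator_of_notMem (fun h' => h ((hA' ω b).1 h'))]

variable (h1 : ends e₁ = s(a, x)) (h2 : ends e₂ = s(x, c))
  (hdeg : ∀ e, x ∈ ends e → e = e₁ ∨ e = e₂) (hax : a ≠ x) (hcx : c ≠ x) (h12 : e₁ ≠ e₂)

include h1 h2 hdeg hax hcx h12 in
omit [Fintype E] [Fintype V] [DecidableEq V] in
/-- A connection event between vertices other than `x` is the preimage of the reduced one. -/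
lemma connEvent_series {m₁ m₂ : V} (hm₁ : m₁ ≠ x) (hm₂ : m₂ ≠ x) :
    connEvent ends m₁ m₂ = seriesMap e₁ e₂ ⁻¹' connEvent (seriesEnds ends e₁ e₂ a c x) m₁ m₂ := by
  ext ω
  simp only [connEvent, Set.mem_setOf_eq, Set.mem_preimage]
  exact (conn_series_iff h1 h2 hdeg hax hcx h12 hm₁ hm₂).symm

include h1 h2 hdeg hax hcx h12 in
omit [Fintype E] [Fintype V] [DecidableEq V] in
/-- The gate is the preimage of the reduced gate under the series map (marks `≠ x`). -/
lemma gate_series {s t u w : V} (hs : s ≠ x) (ht : t ≠ x) (hu : u ≠ x) (hw : w ≠ x) :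
    gate ends s t u w = seriesMap e₁ e₂ ⁻¹' gate (seriesEnds ends e₁ e₂ a c x) s t u w := by
  simp only [gate, bridge, connEvent_series h1 h2 hdeg hax hcx h12 hs ht,
    connEvent_series h1 h2 hdeg hax hcx h12 hs hu, connEvent_series h1 h2 hdeg hax hcx h12 ht hw,
    connEvent_series h1 h2 hdeg hax hcx h12 hs hw, connEvent_series h1 h2 hdeg hax hcx h12 ht hu,
    Set.preimage_inter, Set.preimage_union, Set.preimage_compl]

include h1 h2 hdeg hax hcx h12 in
omit [Fintype E] [Fintype V] [DecidableEq V] in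
/-- `Zev` is the preimage of the reduced `Zev` under the series map (marks `≠ x`). -/
lemma Zev_series {t u w v : V} (ht : t ≠ x) (hu : u ≠ x) (hw : w ≠ x) (hv : v ≠ x) :
    Zev ends t u w v = seriesMap e₁ e₂ ⁻¹' Zev (seriesEnds ends e₁ e₂ a c x) t u w v := by
  simp only [Zev, connEvent_series h1 h2 hdeg hax hcx h12 ht hv,
    connEvent_series h1 h2 hdeg hax hcx h12 hv hu, connEvent_series h1 h2 hdeg hax hcx h12 ht hw,
    connEvent_series h1 h2 hdeg hax hcx h12 hv hw, connEvent_series h1 h2 hdeg hax hcx h12 ht hu,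
    Set.preimage_inter, Set.preimage_union]

omit [Fintype E] [Fintype V] [DecidableEq V] in
/-- The reduced gate does not depend on the loop edge `e₂`. -/
lemma edgeIndep_gate' (s t u w : V) : ∀ ω b,
    Function.update ω e₂ b ∈ gate (seriesEnds ends e₁ e₂ a c x) s t u w ↔
      ω ∈ gate (seriesEnds ends e₁ e₂ a c x) s t u w := by
  have hl : seriesEnds ends e₁ e₂ a c x e₂ = s(x, x) := seriesEnds_apply_e₂
  exact edgeIndep_inter (edgeIndep_compl (edgeIndep_connEvent_loop hl s t))
    (edgeIndep_compl (edgeIndep_union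
      (edgeIndep_inter (edgeIndep_connEvent_loop hl s u) (edgeIndep_connEvent_loop hl t w))
      (edgeIndep_inter (edgeIndep_connEvent_loop hl s w) (edgeIndep_connEvent_loop hl t u))))

omit [Fintype E] [Fintype V] [DecidableEq V] in
/-- The reduced `Zev` does not depend on the loop edge `e₂`. -/
lemma edgeIndep_Zev' (t u w v : V) : ∀ ω b,
    Function.update ω e₂ b ∈ Zev (seriesEnds ends e₁ e₂ a c x) t u w v ↔
      ω ∈ Zev (seriesEnds ends e₁ e₂ a c x) t u w v := by
  have hl : seriesEnds ends e₁ e₂ a c x e₂ = s(x, x) := seriesEnds_apply_e₂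
  exact edgeIndep_union (edgeIndep_union (edgeIndep_connEvent_loop hl t v)
    (edgeIndep_inter (edgeIndep_connEvent_loop hl v u) (edgeIndep_connEvent_loop hl t w)))
    (edgeIndep_inter (edgeIndep_connEvent_loop hl v w) (edgeIndep_connEvent_loop hl t u))

include h1 h2 hdeg hax hcx h12 in
omit [Fintype V] [DecidableEq V] [LinearOrder R] [IsStrictOrderedRing R] in
/-- **Series rule for (MM0⁻)**: suppressing an unmarked vertex of degree two (edges `e₁ = s(a, x)`,
`e₂ = s(x, c)`; merged edge of weight `p e₁ · p e₂`) leaves the cubic form of row 2′MM0 unchanged. -/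
theorem mm0minusForm_series (p : E → R) {s t b u w v : V} (hs : s ≠ x) (ht : t ≠ x) (hb : b ≠ x)
    (hu : u ≠ x) (hw : w ≠ x) (hv : v ≠ x) :
    mm0minusForm p ends s t b u w v =
      mm0minusForm (Function.update p e₁ (p e₁ * p e₂)) (seriesEnds ends e₁ e₂ a c x) s t b u w v := by
  have hl : seriesEnds ends e₁ e₂ a c x e₂ = s(x, x) := seriesEnds_apply_e₂
  have hst := edgeIndep_connEvent_loop hl s t
  have hsb := edgeIndep_connEvent_loop hl s b
  have htv := edgeIndep_connEvent_loop hl t v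
  have hg := edgeIndep_gate' (ends := ends) (e₁ := e₁) (e₂ := e₂) (a := a) (c := c) (x := x) s t u w
  have hz := edgeIndep_Zev' (ends := ends) (e₁ := e₁) (e₂ := e₂) (a := a) (c := c) (x := x) t u w v
  simp only [mm0minusForm, gate_series h1 h2 hdeg hax hcx h12 hs ht hu hw,
    Zev_series h1 h2 hdeg hax hcx h12 ht hu hw hv, connEvent_series h1 h2 hdeg hax hcx h12 hs ht,
    connEvent_series h1 h2 hdeg hax hcx h12 hs hb, connEvent_series h1 h2 hdeg hax hcx h12 ht hv,
    ← Set.preimage_compl, ← Set.preimage_inter]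
  rw [prob_series p h12 _ (edgeIndep_compl hst),
    prob_series p h12 _ (edgeIndep_inter (edgeIndep_inter hsb hz) hg),
    prob_series p h12 _ (edgeIndep_inter hsb (edgeIndep_compl hst)),
    prob_series p h12 _ (edgeIndep_inter hz hg),
    prob_series p h12 _ (edgeIndep_inter htv (edgeIndep_compl hst)),
    prob_series p h12 _ (edgeIndep_inter hsb hg), prob_series p h12 _ hg]

end Masses

end MM0Series
end Summit.Ventures.PercRepro2
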